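import Summits.QuantumFields.YangMills.Theorems.UnitScaleTiltProp7CombVsAxialTransport
import Literature.MathematicalPhysics.QuantumFieldTheory.Balaban1983to89.B9B8AveragedBondsStraight
import HarnessLib

/-!
# Route `UnitScaleTilt`, crux K1 «MinimiserStabilityRegPr» (stmt-QuantumFields-19200) — route-R E′ (A′), LANE II «DIVERGENCE RECOVERY AT CURVED `W`» (★★OWNER RULING №23),
# brick (B2a), sub-pen F4 (★p1 g19 NAMER WORD №6 (3)), FILE F4-W: **THE FRAME-PAIR ROWS OF THE COVARIANT TENT ON `ℤᵈ`** — THIN (one corner-rooted axial frame across one fine bond),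
# FAT (two corner-rooted axial frames at the same site against the corner-to-corner transport), and the coarse staircase of (B3) transporters against the fine one

Cell `ym3-torus` ∕ width seat `ym3-torus-px3` (gen 6).  THEOREMS ONLY (0 `def`, 0 `sorry`); `ℤᵈ`-level, GENERIC over a normed ring `𝔸` with `‖1‖ = 1`, a unit-ball bond field `V` whose
plaquettes are all `a`-close to `1` (at the member: `V := W♯ = pull (bgUnits F K W) (basePt F n K)`, `a := 2e·η²` on `RegPr`, ✓`Prop7OneShotAxialFrameRows.pdev_pull_le_of_regPr`);
`--supports stmt-QuantumFields-19200 --as helper`, count-neutral.  YM₃ on T³ is a ladder rung (R3), not d = 4, not the Clay problem; nothing here claims anything of print beyond the cited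
tree lemmas.

THE ROWS (the `hthin`∕`hfat` slots of ✓`Prop7CovariantTentPointwise.norm_covTent_grad_le` for the frames `σ_{Y′}(z) := axialFn V (blockBase ℓ Y′) z`, `Y′ = ⌊z∕ℓ⌋ − δ`, all roots BELOW `z`):
* §1 THIN ★ `norm_axialFrame_bond_sub_one_le`: `c ≤ z`, `z − c ≤ R` ⇒ `‖σ_c(z)·V(z,μ)·σ_c(z+e_μ)⁻¹ − 1‖ ≤ (d·R)·a` — lit ✓`B8Lemma1NonAbelian.axial_bond_bound_sharp` VERBATIM (the gauged bond variable
  in the axial gauge rooted at `c`), `l1 (lowPart μ (z − c)) ≤ d·R` by px5 g6's ✓`l1_le_mul_of_le`.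
* §2 FAT ★★ `norm_axialFrame_ratio_sub_inv_le`: `c ≤ c′ ≤ z`, `z − c ≤ R` ⇒ `‖σ_{c′}(z)·σ_c(z)⁻¹ − V(Γ_{c,c′})⁻¹‖ ≤ |z − c′|₁·(d·R)·a` — px5 g6's ✓`Prop7CombVsAxialTransport.norm_axialFn_mul_axialFn_sub_axialFn_le`
  («corner → sub-corner → x against corner → x», the fat loop paid in the axial gauge) BY NAME, conjugated into the ratio form (`BC⁻¹ − A⁻¹ = A⁻¹(AB − C)C⁻¹`).
* §3 STAIRCASE ★ `norm_inv_hol_treeWord_sub_inv_axialFn_le`: a coarse unit-ball field `Wc` whose bonds are `E`-close to the straight `M`-segments of `V` transports along the `{0,1}^d` staircase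
  `treeWord δ` within `d·E` of `V(Γ_{M(Y−δ), MY})` — px5 g6's ✓`norm_hol_treeWord_sub_hol_treeWord_le` BY NAME + lit ✓`B9B8AveragedBondsStraight.norm_inv_sub_inv_le`; at the member `Wc := pull T 0`
  (the (B3) transporter read on `ℤ³`) and the bond closeness is the (B3c) rider of ★p1 g19's SIGNATURE-0 (B2a).
* §4 ★★★ `norm_frameRatio_sub_inv_hol_treeWord_le`: §2 + §3 — the `hfat` slot with `P δ := (Wc-staircase)⁻¹`, constant `|z − MY|₁·(d·R)·a + d·E` (member: `≤ 4d²e + d·CT·e`).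
HONEST SCOPE.  Three citations and unit-ball algebra; no estimate of print re-derived; rung R3, not Clay; YM gap NOT proved.

References: T. Bałaban, CMP **98** (1985) 17–51 [Balaban1985Averaging] ((8)–(9) p.18, pp.24–25, (52)–(53) p.27); CMP **99** (1985) 75–102 [Balaban1985RegularSpaces] (Lemma 1 (1.25) p.79, (1.70) p.88).
-/

set_option autoImplicit false

noncomputable section

open scoped BigOperators

namespace Summit.QuantumFields.YangMills.Theorems.Prop7AxialFramePairRows

open Literature.MathematicalPhysics.QuantumFieldTheory.Balaban1983to89
open Literature.MathematicalPhysics.QuantumLattice (blockMap blockBase)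
open B7Prop1Explicit (Site Letter e hol seg treeWord axialFn gaugeAct U1 l1 disp disp_treeWord hol_mem axialFn_mem mem_U1 plaqWord)
open B8Lemma1NonAbelian (PlaqSmall axial_bond_bound_sharp lowPart lowPart_nonneg lowPart_le_self)
open B9B8AveragedBondsStraight (norm_inv_sub_inv_le)
open Summit.QuantumFields.YangMills.Theorems.Prop7CombVsAxialTransport (l1_le_mul_of_le norm_axialFn_mul_axialFn_sub_axialFn_le norm_hol_treeWord_sub_hol_treeWord_le)

variable {d : ℕ} {𝔸 : Type*} [NormedRing 𝔸] [NormOneClass 𝔸]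

/-! ## §1 THIN: one corner-rooted axial frame across one fine bond -/

/-- ★ **THIN ROW**: for a unit-ball `V` with all plaquettes `a`-close to `1`, a root `c ≤ z` with `z − c ≤ R` coordinatewise, the bond variable `V(z, z+e_μ)` read between the axial frames
rooted at `c` is within `(d·R)·a` of `1`: `‖σ_c(z)·V(z,μ)·σ_c(z + e_μ)⁻¹ − 1‖ ≤ (d·R)·a` (it IS the gauged bond variable `V^{σ_c}(z,μ)` of the axial gauge at `c`).
[cite: Balaban1985Averaging, pp.24-25; Balaban1985RegularSpaces, Lemma 1 (1.25) p.79] -/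
theorem norm_axialFrame_bond_sub_one_le {V : Site d → Fin d → 𝔸ˣ} (hV : ∀ x κ, V x κ ∈ U1 𝔸) {a : ℝ} (ha : 0 ≤ a)
    (hP : ∀ (x : Site d) (κ μ : Fin d), κ ≠ μ → ‖((hol V x (plaqWord κ μ) : 𝔸ˣ) : 𝔸) - 1‖ ≤ a)
    (c z : Site d) (hcz : c ≤ z) {R : ℕ} (hR : ∀ i, z i - c i ≤ R) (μ : Fin d) :
    ‖((axialFn V c z * V z μ * (axialFn V c (z + e μ))⁻¹ : 𝔸ˣ) : 𝔸) - 1‖ ≤ ((d : ℝ) * R) * a := by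
  have hPl : PlaqSmall V c (z + e μ) a := fun x κ ν hκν _ _ => hP x κ ν hκν
  have hb := axial_bond_bound_sharp V hV hPl c z μ le_rfl hcz le_rfl
  have hzc : 0 ≤ z - c := sub_nonneg.2 hcz
  have hl1 : (l1 (lowPart μ (z - c)) : ℝ) ≤ d * R := by
    exact_mod_cast l1_le_mul_of_le (lowPart_nonneg _ hzc) fun i => ((lowPart_le_self _ hzc) i).trans (by simpa using hR i)
  exact hb.trans (mul_le_mul_of_nonneg_right hl1 ha)

/-! ## §2 FAT: two corner-rooted axial frames at one site against the corner-to-corner transport -/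

/-- ★★ **FAT ROW**: roots `c ≤ c′ ≤ z`, `z − c ≤ R` coordinatewise ⇒ `‖σ_{c′}(z)·σ_c(z)⁻¹ − V(Γ_{c,c′})⁻¹‖ ≤ |z − c′|₁·(d·R)·a` — px5 g6's «two nested axial transporters against one»
conjugated: `σ_{c′}(z)σ_c(z)⁻¹ − V(Γ_{c,c′})⁻¹ = V(Γ_{c,c′})⁻¹·(V(Γ_{c,c′})σ_{c′}(z) − σ_c(z))·σ_c(z)⁻¹`. [cite: Balaban1985Averaging, pp.24-25; Balaban1985RegularSpaces, (1.70) p.88] -/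
theorem norm_axialFrame_ratio_sub_inv_le {V : Site d → Fin d → 𝔸ˣ} (hV : ∀ x κ, V x κ ∈ U1 𝔸) {a : ℝ} (ha : 0 ≤ a)
    (hP : ∀ (x : Site d) (κ μ : Fin d), κ ≠ μ → ‖((hol V x (plaqWord κ μ) : 𝔸ˣ) : 𝔸) - 1‖ ≤ a)
    (c c' z : Site d) (hcc' : c ≤ c') (hc'z : c' ≤ z) {R : ℕ} (hR : ∀ i, z i - c i ≤ R) :
    ‖((axialFn V c' z * (axialFn V c z)⁻¹ : 𝔸ˣ) : 𝔸) - (((axialFn V c c')⁻¹ : 𝔸ˣ) : 𝔸)‖ ≤ (l1 (z - c') : ℝ) * (((d : ℝ) * R) * a) := by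
  have h := norm_axialFn_mul_axialFn_sub_axialFn_le hV ha hP c c' z hcc' hc'z hR
  set A := axialFn V c c'
  set B := axialFn V c' z
  set C := axialFn V c z
  have hid : ((B * C⁻¹ : 𝔸ˣ) : 𝔸) - ((A⁻¹ : 𝔸ˣ) : 𝔸) = ((A⁻¹ : 𝔸ˣ) : 𝔸) * (((A * B : 𝔸ˣ) : 𝔸) - (C : 𝔸)) * ((C⁻¹ : 𝔸ˣ) : 𝔸) := by
    rw [mul_sub, sub_mul, Units.val_mul, Units.val_mul, ← mul_assoc ((A⁻¹ : 𝔸ˣ) : 𝔸), Units.inv_mul, one_mul, mul_assoc ((A⁻¹ : 𝔸ˣ) : 𝔸), Units.mul_inv, mul_one]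
  rw [hid]
  have hA : ‖((A⁻¹ : 𝔸ˣ) : 𝔸)‖ ≤ 1 := (mem_U1.1 (axialFn_mem hV c c')).2
  have hC : ‖((C⁻¹ : 𝔸ˣ) : 𝔸)‖ ≤ 1 := (mem_U1.1 (axialFn_mem hV c z)).2
  calc _ ≤ ‖((A⁻¹ : 𝔸ˣ) : 𝔸)‖ * ‖((A * B : 𝔸ˣ) : 𝔸) - (C : 𝔸)‖ * ‖((C⁻¹ : 𝔸ˣ) : 𝔸)‖ := norm_mul₃_le
    _ ≤ 1 * ‖((A * B : 𝔸ˣ) : 𝔸) - (C : 𝔸)‖ * 1 := by gcongr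
    _ = ‖((A * B : 𝔸ˣ) : 𝔸) - (C : 𝔸)‖ := by rw [one_mul, mul_one]
    _ ≤ _ := h

/-! ## §3 The coarse `{0,1}^d` staircase of (B3)-type transporters against the fine corner-to-corner transport -/

/-- The `{0,1}`-vector of an offset `δ : Fin d → Fin 2`, read in `ℤᵈ`, is nonnegative with entries `≤ 1`. [folklore] -/
theorem offsetVec_nonneg_le_one (δ : Fin d → Fin 2) : (0 : Site d) ≤ (fun i => ((δ i : ℕ) : ℤ)) ∧ ∀ i, (fun i => ((δ i : ℕ) : ℤ)) i ≤ (1 : ℕ) := by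
  refine ⟨fun i => by simp, fun i => ?_⟩
  have := (δ i).isLt
  simp only [Nat.cast_one]; omega

/-- ★ **STAIRCASE ROW** (inverse form): a unit-ball coarse field `Wc` whose bond variables are `E`-close to the straight `M`-segments of `V` (`‖Wc(Y,κ) − V(MY; seg_κ M)‖ ≤ E`)
transports along the staircase `treeWord δ` from `Y − δ` within `d·E` of the fine corner-to-corner transport, hence so do the inverses:
`‖Wc(Y − δ; treeWord δ)⁻¹ − V(Γ_{M(Y−δ), MY})⁻¹‖ ≤ d·E`. [cite: Balaban1985Averaging, (9) p.18, (43) p.24, pp.24-25] -/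
theorem norm_inv_hol_treeWord_sub_inv_axialFn_le {Wc V : Site d → Fin d → 𝔸ˣ} (hW : ∀ x κ, Wc x κ ∈ U1 𝔸) (hV : ∀ x κ, V x κ ∈ U1 𝔸)
    (M : ℕ) {E : ℝ} (hE : 0 ≤ E)
    (hbond : ∀ (Y : Site d) (κ : Fin d), ‖((Wc Y κ : 𝔸ˣ) : 𝔸) - ((hol V ((M : ℤ) • Y) (seg κ (M : ℤ)) : 𝔸ˣ) : 𝔸)‖ ≤ E)
    (Y : Site d) (δ : Fin d → Fin 2) :
    ‖(((hol Wc (Y - fun i => ((δ i : ℕ) : ℤ)) (treeWord (fun i => ((δ i : ℕ) : ℤ))))⁻¹ : 𝔸ˣ) : 𝔸)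
        - (((axialFn V ((M : ℤ) • (Y - fun i => ((δ i : ℕ) : ℤ))) ((M : ℤ) • Y))⁻¹ : 𝔸ˣ) : 𝔸)‖ ≤ (d : ℝ) * E := by
  set v : Site d := fun i => ((δ i : ℕ) : ℤ) with hv
  have hv0 : (0 : Site d) ≤ v := (offsetVec_nonneg_le_one δ).1
  have h := norm_hol_treeWord_sub_hol_treeWord_le hW hV M hE hbond v hv0 (Y - v)
  have hax : axialFn V ((M : ℤ) • (Y - v)) ((M : ℤ) • Y) = hol V ((M : ℤ) • (Y - v)) (treeWord ((M : ℤ) • v)) := by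
    show hol V _ (treeWord ((M : ℤ) • Y - (M : ℤ) • (Y - v))) = _
    rw [smul_sub, sub_sub_cancel]
  have hl1 : (l1 v : ℝ) ≤ d := by
    have := l1_le_mul_of_le hv0 (R := 1) (offsetVec_nonneg_le_one δ).2
    exact_mod_cast (by simpa using this)
  rw [hax]
  refine (norm_inv_sub_inv_le (hol_mem hW _ _) (hol_mem hV _ _)).trans (h.trans ?_)
  exact (mul_le_mul_of_nonneg_right hl1 hE).trans (le_of_eq (by ring))

/-! ## §4 The `hfat` slot of the covariant tent: frame ratio against the inverse coarse staircase -/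

/-- ★★★ **THE FAT SLOT OF ✓`norm_covTent_grad_le`∕✓`norm_sub_avg_covTent_le`**: with roots `c′ = M·Y` (the box corner of `z`, `M·Y ≤ z`, `z − M(Y − δ) ≤ R`) and `c = M·(Y − δ)`,
and `P δ := Wc(Y − δ; treeWord δ)⁻¹` the inverse coarse staircase of the (B3)-type field: `‖σ_{MY}(z)·σ_{M(Y−δ)}(z)⁻¹ − P δ‖ ≤ |z − MY|₁·(d·R)·a + d·E`.
At the member (`M = ℓ`, `R = 2ℓ`, `a = 2e·η²`, `|z − ℓY|₁ ≤ d(ℓ − 1)`, `E = CT·e`): `≤ 4d²·e + d·CT·e`, L-free. [cite: Balaban1985Averaging, pp.24-25, (52)-(53) p.27; Balaban1985RegularSpaces, (1.70) p.88] -/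
theorem norm_frameRatio_sub_inv_hol_treeWord_le {Wc V : Site d → Fin d → 𝔸ˣ} (hW : ∀ x κ, Wc x κ ∈ U1 𝔸) (hV : ∀ x κ, V x κ ∈ U1 𝔸) {a : ℝ} (ha : 0 ≤ a)
    (hP : ∀ (x : Site d) (κ μ : Fin d), κ ≠ μ → ‖((hol V x (plaqWord κ μ) : 𝔸ˣ) : 𝔸) - 1‖ ≤ a)
    (M : ℕ) {E : ℝ} (hE : 0 ≤ E)
    (hbond : ∀ (Y : Site d) (κ : Fin d), ‖((Wc Y κ : 𝔸ˣ) : 𝔸) - ((hol V ((M : ℤ) • Y) (seg κ (M : ℤ)) : 𝔸ˣ) : 𝔸)‖ ≤ E)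
    (Y z : Site d) (δ : Fin d → Fin 2) (hYz : (M : ℤ) • Y ≤ z) {R : ℕ} (hR : ∀ i, z i - ((M : ℤ) • (Y - fun i => ((δ i : ℕ) : ℤ))) i ≤ R) :
    ‖((axialFn V ((M : ℤ) • Y) z * (axialFn V ((M : ℤ) • (Y - fun i => ((δ i : ℕ) : ℤ))) z)⁻¹ : 𝔸ˣ) : 𝔸)
        - (((hol Wc (Y - fun i => ((δ i : ℕ) : ℤ)) (treeWord (fun i => ((δ i : ℕ) : ℤ))))⁻¹ : 𝔸ˣ) : 𝔸)‖
      ≤ (l1 (z - (M : ℤ) • Y) : ℝ) * (((d : ℝ) * R) * a) + (d : ℝ) * E := by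
  set v : Site d := fun i => ((δ i : ℕ) : ℤ) with hv
  have hv0 : (0 : Site d) ≤ v := (offsetVec_nonneg_le_one δ).1
  have hcc' : (M : ℤ) • (Y - v) ≤ (M : ℤ) • Y := by
    intro i
    simp only [Pi.smul_apply, Pi.sub_apply, smul_eq_mul]
    have h0 : 0 ≤ v i := hv0 i
    have hM : (0 : ℤ) ≤ M := by positivity
    nlinarith
  have h1 := norm_axialFrame_ratio_sub_inv_le hV ha hP ((M : ℤ) • (Y - v)) ((M : ℤ) • Y) z hcc' hYz hR
  have h2 := norm_inv_hol_treeWord_sub_inv_axialFn_le hW hV M hE hbond Y δ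
  rw [norm_sub_rev] at h2
  exact (norm_sub_le_norm_sub_add_norm_sub _ _ _).trans (add_le_add h1 h2)

end Summit.QuantumFields.YangMills.Theorems.Prop7AxialFramePairRows

end
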